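import Literature.Computability.AlgebraicComplexity.QuantumFunctionals
import HarnessLib

/-!
# The quantum functionals as points of the asymptotic spectrum `Δ(T)` over `ℂ`

Topic `Literature/Computability/AlgebraicComplexity`; definition item `defn-quantumFunctional`
(route `MatrixMultiplication/AsymptoticSpectrum`, statement `stmt-MatrixMultiplication-0582`,
"every universal spectral point of complex 3-tensors equals `F^θ` for some `θ ∈ P([3])`").

The functional itself is already in the tree: `Literature.CplxAlg.quantumFunctional θ t = F^θ(t)`
(`QuantumFunctionals.lean`, CVZ Def. 3.16), together with the named facts
`ChristandlVranaZuiddam2023_unitTensor/_directSum/_kronecker/_restriction_mono/_bounds` and their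
conjunction `ChristandlVranaZuiddam2023_universalSpectralPoint` (Cor. 3.31). What the requesting
statement additionally needs is `F^θ` *as an element of the type on which the tree's asymptotic
spectrum lives*: `IsUniversalSpectralPoint ℂ F` and `asymptoticSpectrum ℂ` (`AsymptoticSpectrum.lean`)
take `F : SpectralMap ℂ = ∀ ⦃ι κ μ : Type⦄, (ι → κ → μ → ℂ) → ℝ`, a function on tensors of *all*
index types, whereas `quantumFunctional` needs `[Fintype]` and `[DecidableEq]` instances (spectra of
reduced density matrices). This file supplies the packaging and the bridge.

## Content

* `quantumFunctionalPoint θ : SpectralMap ℂ` — `F^θ` as a spectral map: on finite index types it is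
  `quantumFunctional θ` evaluated with the (unique up to `Subsingleton`) classical `Fintype`/`DecidableEq`
  instances; on infinite index types the junk value `0` (values there are never constrained by
  `IsUniversalSpectralPoint`, see the design notes of `AsymptoticSpectrum.lean`).
* `quantumFunctionalPoint_apply` — for *any* instances, `quantumFunctionalPoint θ t = quantumFunctional θ t`.
* `ChristandlVranaZuiddam2023_mem_asymptoticSpectrum` — the main theorem of CVZ in the tree's language:
  `∀ θ ∈ P([3]), quantumFunctionalPoint θ ∈ asymptoticSpectrum ℂ` (Cor. 3.31: "Let `θ ∈ P_s(B)`. Then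
  `F^θ = F_θ` is a point in the asymptotic spectrum `Δ(T)`, a universal spectral point"; for `k = 3`,
  `P_s(B) = P([3])`). Named fact, `def … : Prop`.
* Bridge (proved): `ChristandlVranaZuiddam2023_universalSpectralPoint.{0}` (the conjunction of the four
  printed properties) implies `ChristandlVranaZuiddam2023_mem_asymptoticSpectrum`; conversely membership
  gives back additivity, multiplicativity and restriction-monotonicity of `quantumFunctional θ` on index
  types in `Type`.
* Consequences with Strassen duality (proved from the named facts): `Q̃(t) ≤ F^θ(t) ≤ R̃(t)` (CVZ §1.1,
  p. 4: "Spectral points … are thus between asymptotic subrank and asymptotic rank").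

## Design choices

* No new mathematics is defined: `quantumFunctionalPoint` is a repackaging of `quantumFunctional`; the
  `dite` on `Finite ι ∧ Finite κ ∧ Finite μ` is the only way to inhabit `SpectralMap ℂ` (which ranges over
  all index types) from a definition that needs finiteness. Instance-independence
  (`quantumFunctionalPoint_apply`) is by `Subsingleton (Fintype _)` and `Subsingleton (DecidableEq _)`.
* Universe: `SpectralMap` fixes index types in `Type`, so the bridge uses the universe-`0` instances of the
  universe-polymorphic facts of `QuantumFunctionals.lean`.
* Not vendored: the requester's "`F^θ(t) ≤ maxᵢ` flattening rank`ᵢ(t)`". The printed bound is Thm. 3.19.5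
  (`ChristandlVranaZuiddam2023_bounds`, in terms of the dimensions `min(dim V_j, dim V_{[3]∖j})`); the
  flattening-rank form `F^θ(t) ≤ ∏ⱼ Rⱼ(t)^{θ(j)}` follows from the proof of Ex. 3.18 ("the quantum entropy of
  a density matrix is at most [log₂ of] its matrix rank") and `GL`-invariance of flattening ranks, but is not
  a printed statement of the source, so it is left to the problem side (or a later proof here).

## Source

M. Christandl, P. Vrana, J. Zuiddam, *Universal points in the asymptotic spectrum of tensors*,
J. Amer. Math. Soc. 36 (2023) 31–79 = arXiv:1709.07851: §1.1 (pp. 3–4), Def. 3.16, Cor. 3.31.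
-/

noncomputable section

open scoped BigOperators

namespace Literature.Computability.AlgebraicComplexity

/-! ## `F^θ` as a spectral map -/

section Point

/-- The **quantum functional `F^θ` as a spectral map** on all complex 3-tensors with index types in
`Type`: for finite index types, `F^θ(t) = quantumFunctional θ t` (CVZ Def. 3.16), computed with the
classical `Fintype`/`DecidableEq` instances (any other instances give the same value,
`quantumFunctionalPoint_apply`); for infinite index types the junk value `0` (never constrained by
`IsUniversalSpectralPoint`). This is the object of which CVZ Cor. 3.31 asserts membership in `Δ(T)`.
[cite: ChristandlVranaZuiddam2023, Def. 3.16] -/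
def quantumFunctionalPoint (θ : Fin 3 → ℝ) : SpectralMap ℂ :=
  fun ι κ μ t =>
    open Classical in
    if h : Finite ι ∧ Finite κ ∧ Finite μ then
      haveI := h.1
      haveI := h.2.1
      haveI := h.2.2
      letI := Fintype.ofFinite ι
      letI := Fintype.ofFinite κ
      letI := Fintype.ofFinite μ
      quantumFunctional θ t
    else 0

variable {ι κ μ : Type} (θ : Fin 3 → ℝ)

/-- **Instance independence**: on finite index types, `quantumFunctionalPoint θ t = F^θ(t)` for every
choice of `Fintype`/`DecidableEq` instances. [folklore] -/
@[simp] theorem quantumFunctionalPoint_apply [Fintype ι] [Fintype κ] [Fintype μ] [DecidableEq ι]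
    [DecidableEq κ] [DecidableEq μ] (t : ι → κ → μ → ℂ) :
    quantumFunctionalPoint θ t = quantumFunctional θ t := by
  have h : Finite ι ∧ Finite κ ∧ Finite μ :=
    ⟨Finite.of_fintype ι, Finite.of_fintype κ, Finite.of_fintype μ⟩
  simp only [quantumFunctionalPoint, dif_pos h]
  congr <;> apply Subsingleton.elim

/-- On an infinite first index type the value is the junk `0`. [folklore] -/
theorem quantumFunctionalPoint_of_infinite [Infinite ι] (t : ι → κ → μ → ℂ) :
    quantumFunctionalPoint θ t = 0 := by
  have h : ¬(Finite ι ∧ Finite κ ∧ Finite μ) := fun h => (haveI := h.1; not_finite ι)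
  simp only [quantumFunctionalPoint, dif_neg h]

/-- `quantumFunctionalPoint θ 0 = 0` on finite formats (`F^θ(0) = 0`).
[cite: ChristandlVranaZuiddam2023, Def. 3.16] -/
theorem quantumFunctionalPoint_zero [Fintype ι] [Fintype κ] [Fintype μ] :
    quantumFunctionalPoint θ (0 : ι → κ → μ → ℂ) = 0 := by
  classical
  rw [quantumFunctionalPoint_apply, quantumFunctional_zero]

/-- `0 ≤ quantumFunctionalPoint θ t` always (on finite formats `F^θ ≥ 0`, else the junk `0`). [folklore] -/
theorem quantumFunctionalPoint_nonneg (t : ι → κ → μ → ℂ) : 0 ≤ quantumFunctionalPoint θ t := by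
  classical
  unfold quantumFunctionalPoint
  split_ifs with h
  · obtain ⟨h₁, h₂, h₃⟩ := h
    letI := Fintype.ofFinite ι
    letI := Fintype.ofFinite κ
    letI := Fintype.ofFinite μ
    convert quantumFunctional_nonneg θ t
  · exact le_rfl

/-- On finite formats and for `θ ≥ 0`, `1 ≤ quantumFunctionalPoint θ t` for `t ≠ 0`. [folklore] -/
theorem one_le_quantumFunctionalPoint [Fintype ι] [Fintype κ] [Fintype μ] {θ : Fin 3 → ℝ}
    (hθ : ∀ i, 0 ≤ θ i) {t : ι → κ → μ → ℂ} (ht : t ≠ 0) : 1 ≤ quantumFunctionalPoint θ t := by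
  classical
  rw [quantumFunctionalPoint_apply]
  exact one_le_quantumFunctional hθ ht

end Point

/-! ## The main theorem of CVZ in the language of `asymptoticSpectrum ℂ` -/

section Facts

/-- **Christandl–Vrana–Zuiddam, Cor. 3.31 (main theorem), as membership in `Δ(T)`**: "Let
`θ ∈ P_s(B)`. Then `F^θ = F_θ` is a point in the asymptotic spectrum `Δ(T)`, a universal spectral
point." For 3-tensors `P_s(B) = P([3])` (CVZ §3, `k ≤ 3`), so: for every `θ` in the probability simplex
on `Fin 3`, `quantumFunctionalPoint θ` is a universal spectral point over `ℂ` in the sense of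
`IsUniversalSpectralPoint` (additive under `⊕`, multiplicative under `⊗`, `F(⟨1⟩) = 1`, monotone under
restriction, nonnegative). Equivalent packaging of `ChristandlVranaZuiddam2023_universalSpectralPoint.{0}`
(see `.mem_asymptoticSpectrum`). Known theorem; statement only.
[cite: ChristandlVranaZuiddam2023, Cor. 3.31] -/
def ChristandlVranaZuiddam2023_mem_asymptoticSpectrum : Prop :=
  ∀ θ : Fin 3 → ℝ, θ ∈ stdSimplex ℝ (Fin 3) → quantumFunctionalPoint θ ∈ asymptoticSpectrum ℂ

/-- **Bridge**: the four printed properties of `F^θ` (Thm. 3.19.1, Cor. 3.31) give a universal spectral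
point in the tree's sense. [cite: ChristandlVranaZuiddam2023, Cor. 3.31] -/
theorem ChristandlVranaZuiddam2023_universalSpectralPoint.isUniversalSpectralPoint
    (h : ChristandlVranaZuiddam2023_universalSpectralPoint.{0}) {θ : Fin 3 → ℝ}
    (hθ : θ ∈ stdSimplex ℝ (Fin 3)) : IsUniversalSpectralPoint ℂ (quantumFunctionalPoint θ) := by
  classical
  obtain ⟨h1, h2, h3, h4⟩ := h
  refine ⟨?_, ?_, ?_, ?_, ?_⟩
  · intro ι κ μ _ _ _ t
    exact quantumFunctionalPoint_nonneg θ t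
  · intro ι κ μ ι' κ' μ' _ _ _ _ _ _ s t
    simp only [quantumFunctionalPoint_apply]
    convert h2 θ hθ s t
  · intro ι κ μ ι' κ' μ' _ _ _ _ _ _ s t
    simp only [quantumFunctionalPoint_apply]
    convert h3 θ hθ s t
  · simp only [quantumFunctionalPoint_apply]
    have := h1 θ hθ 1
    simpa using this
  · intro ι κ μ ι' κ' μ' _ _ _ _ _ _ t s hts
    simp only [quantumFunctionalPoint_apply]
    exact h4.of_tensorRestrictsTo hθ hts

/-- **Bridge**: `ChristandlVranaZuiddam2023_universalSpectralPoint.{0}` implies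
`ChristandlVranaZuiddam2023_mem_asymptoticSpectrum`. [cite: ChristandlVranaZuiddam2023, Cor. 3.31] -/
theorem ChristandlVranaZuiddam2023_universalSpectralPoint.mem_asymptoticSpectrum
    (h : ChristandlVranaZuiddam2023_universalSpectralPoint.{0}) :
    ChristandlVranaZuiddam2023_mem_asymptoticSpectrum :=
  fun _ hθ => h.isUniversalSpectralPoint hθ

namespace ChristandlVranaZuiddam2023_mem_asymptoticSpectrum

variable (h : ChristandlVranaZuiddam2023_mem_asymptoticSpectrum) {θ : Fin 3 → ℝ}
  (hθ : θ ∈ stdSimplex ℝ (Fin 3))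
include h hθ

/-- Membership unfolded. [cite: ChristandlVranaZuiddam2023, Cor. 3.31] -/
theorem isUniversalSpectralPoint : IsUniversalSpectralPoint ℂ (quantumFunctionalPoint θ) := h θ hθ

/-- Converse direction of the bridge, additivity: `F^θ(s ⊕ t) = F^θ(s) + F^θ(t)` for index types in
`Type`. [cite: ChristandlVranaZuiddam2023, Cor. 3.31] -/
theorem directSum {ι κ μ ι' κ' μ' : Type} [Fintype ι] [Fintype κ] [Fintype μ] [Fintype ι']
    [Fintype κ'] [Fintype μ'] [DecidableEq ι] [DecidableEq κ] [DecidableEq μ] [DecidableEq ι']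
    [DecidableEq κ'] [DecidableEq μ'] (s : ι → κ → μ → ℂ) (t : ι' → κ' → μ' → ℂ) :
    quantumFunctional θ (directSumTensor s t) = quantumFunctional θ s + quantumFunctional θ t := by
  simpa only [quantumFunctionalPoint_apply] using (h θ hθ).map_directSum s t

/-- Converse direction of the bridge, multiplicativity: `F^θ(s ⊗ t) = F^θ(s) F^θ(t)` for index types in
`Type`. [cite: ChristandlVranaZuiddam2023, Cor. 3.31] -/
theorem kronecker {ι κ μ ι' κ' μ' : Type} [Fintype ι] [Fintype κ] [Fintype μ] [Fintype ι']
    [Fintype κ'] [Fintype μ'] [DecidableEq ι] [DecidableEq κ] [DecidableEq μ] [DecidableEq ι']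
    [DecidableEq κ'] [DecidableEq μ'] (s : ι → κ → μ → ℂ) (t : ι' → κ' → μ' → ℂ) :
    quantumFunctional θ (kroneckerTensor s t) = quantumFunctional θ s * quantumFunctional θ t := by
  simpa only [quantumFunctionalPoint_apply] using (h θ hθ).map_kronecker s t

/-- Converse direction of the bridge, monotonicity: `t ≥ s → F^θ(s) ≤ F^θ(t)` for index types in `Type`.
[cite: ChristandlVranaZuiddam2023, Cor. 3.31] -/
theorem mono {ι κ μ ι' κ' μ' : Type} [Fintype ι] [Fintype κ] [Fintype μ] [Fintype ι']
    [Fintype κ'] [Fintype μ'] [DecidableEq ι] [DecidableEq κ] [DecidableEq μ] [DecidableEq ι']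
    [DecidableEq κ'] [DecidableEq μ'] {t : ι → κ → μ → ℂ} {s : ι' → κ' → μ' → ℂ}
    (hts : TensorRestrictsTo t s) : quantumFunctional θ s ≤ quantumFunctional θ t := by
  simpa only [quantumFunctionalPoint_apply] using (h θ hθ).mono t s hts

/-- `F^θ(⟨1⟩) = 1`. [cite: ChristandlVranaZuiddam2023, Thm. 3.19.1] -/
theorem unitTensor_one : quantumFunctional θ (unitTensor ℂ 1) = 1 := by
  simpa only [quantumFunctionalPoint_apply] using (h θ hθ).map_unitTensor_one

/-- **`F^θ(t) ≤ R̃(t)`** (CVZ §1.1, p. 4: "Spectral points … are thus between asymptotic subrank and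
asymptotic rank"), from membership in `Δ(T)` and Strassen duality for the asymptotic rank
(`strassen_duality_asymptoticRank`, CVZ Prop. 1.6). [cite: ChristandlVranaZuiddam2023, §1.1 (p. 4)] -/
theorem le_asymptoticRank (hd : strassen_duality_asymptoticRank ℂ) {ι κ μ : Type} [Fintype ι]
    [Fintype κ] [Fintype μ] [DecidableEq ι] [DecidableEq κ] [DecidableEq μ] (t : ι → κ → μ → ℂ) :
    quantumFunctional θ t ≤ asymptoticRank t := by
  simpa only [quantumFunctionalPoint_apply] using (hd t).1 _ (h θ hθ)

/-- **`Q̃(t) ≤ F^θ(t)`** (CVZ §1.1, p. 4), from membership in `Δ(T)` and Strassen duality for the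
asymptotic subrank (`strassen_duality_asymptoticSubrank`, CVZ Prop. 1.6).
[cite: ChristandlVranaZuiddam2023, §1.1 (p. 4)] -/
theorem asymptoticSubrank_le (hd : strassen_duality_asymptoticSubrank ℂ) {ι κ μ : Type} [Fintype ι]
    [Fintype κ] [Fintype μ] [DecidableEq ι] [DecidableEq κ] [DecidableEq μ] (t : ι → κ → μ → ℂ) :
    asymptoticSubrank ℂ t ≤ quantumFunctional θ t := by
  simpa only [quantumFunctionalPoint_apply] using (hd t).1 _ (h θ hθ)

end ChristandlVranaZuiddam2023_mem_asymptoticSpectrum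

end Facts

end Literature.Computability.AlgebraicComplexity

end
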